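import Summits.BirchSwinnertonDyer.Rank1Residual.X11b.Three.GoodReductionSubgroupUnramified
import Mathlib.RingTheory.IntegralClosure.IsIntegralClosure.Basic
import HarnessLib

/-!
# X11b at `p = 3` (team N8/O2), JET3-KUMMER help-wanted (α) and `hstab`: Galois stability of
# `E₀(L)`, the reduction of `H¹(Gal(L/F), E₀(L)) = 0` to its formal-group half and its `Ẽ_ns`
# half, and the end form `T ∈ E₀(K_v) + p^m E(K_v)` at the bad place `v`

HONEST FRAMING (cell `b2b-bsdres`, run/shared/lean/b2b/bsd-rank1-residual/, verbatim in every
file): the goal of the cell is to DELETE the COMBINATION-SHAPED residual classes of the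
Birch–Swinnerton-Dyer formula for ALL analytic-rank `≤ 1` elliptic curves over `ℚ` — "full BSD
formula for every rank `≤ 1` curve in class `C`" assembled STRICTLY from published theorems — so
that the rank-`≤ 1` remainder becomes exactly the CONSTRUCTION-SHAPED classes, which are TYPED
(missing-input `Prop`s), NOT attempted. This is not "finishing BSD". Team N8/O2 = `x11b3`, seat
`b2b-bsdres-x11b3-p4`, LEAD DEAL #4 (R3/A4.1) row "JET3-KUMMER help-wanted (d) + (α)" for p1's
`X11b/Three/JetchevKummerAtP.lean` (p251610); part 2 of 2 (part 1:
`GoodReductionSubgroupUnramified.lean` — (d) and Galois descent). THEOREMS ONLY: no definition,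
no named fact, no `sorry`; nothing is booked; the flag `JET@p|N` is NOT discharged; the two halves
of (α) are HYPOTHESES (named stubs), not proved here.

Setting: p1's dictionary (see part 1): `F = K_v ⊇ R₀`, `L = K[c]_w ⊇ R`, `W / F`,
`E₀(L) = (W ⊗ L).goodReductionSubgroup R`, `D = Gal(L/F) = L ≃ₐ[F] L`,
`ι = Affine.Point.baseChange F L : E(F) → E(L)`.

## What is proved

* §3 **`hstab`** (p1's hypothesis: `E₀(L)` is `D`-stable): `smul_mem_goodReductionSubgroup`, from
  `σ(R) ⊆ R` for all `σ ∈ D` — discharged by `algEquiv_apply_mem_range_of_isIntegralClosure` when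
  `R` is the integral closure of `R₀` in `L` (the ring of integers of `L`;
  `smul_mem_goodReductionSubgroup_of_isIntegralClosure`). Proof: `σ` restricts to an
  automorphism of `R`, hence a local one, inducing `σ̄` on the residue field; `σ̄` fixes the reduced
  equation (its coefficients come from `F`) and preserves nonsingularity (Mathlib
  `Affine.map_nonsingular`); same mechanism as the tree's `reducesToNonsingular_map_iff_of_forall_eq`
  (`TateNormalFormUnramifiedComponentsProofs`, for isometries of `K̄_v`). Neukirch *ANT* II §9;
  Silverman *AEC* VII.2.
* §4 **(α) reduced to two halves** (pure algebra, then on points). For `D` cyclic generated by `φ`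
  with `φⁿ = 1` (an unramified `L/F`: `φ` = Frobenius, `n = [L : F]`): p1's hypothesis `hα`
  ("`(E(L)/E₀(L))^D` is the image of `E(L)^D`", i.e. the vanishing of
  `im(H¹(D, E₀(L)) → H¹(D, E(L)))`) follows from the cyclic-group form of `H¹(D, E₀(L)) = 0`
  (`exists_fixed_sub_mem_of_cyclic`, `hα_of_cyclicH1`: every `m ∈ E₀(L)` with `Σ_{j<n} φʲ m = O`
  is `φ P − P`, `P ∈ E₀(L)`), which follows (`cyclicH1_of_subset`, `hα_of_cyclic_of_halves`) from
  the two halves of the dévissage `0 → E₁(L) → E₀(L) → Ẽ_ns(k) → 0` (*AEC* VII.2.1):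
  - `h1ker` — **formal-group half**, `H¹(D, E₁(L)) = 0` in cyclic form (successive approximation
    on `Ê(𝔪ʳ)`, graded pieces `k⁺`, additive Hilbert 90; the tree's ABSTRACT theorem
    `Literature.NumberTheory.EllipticCurves.FormalGroupChart.exists_map_sub_eq_of_sum_eq_zero`
    (`UnramifiedFormalGroupH1Proofs`) under its hypotheses (i)–(iv) — NOT instantiated here);
  - `h1red` — **`Ẽ_ns` half**, LIFTED to `E₀(L)`: every `m ∈ E₀(L)` with `Σ φʲ m = O` is
    congruent to some `φ C − C` modulo `E₁(L)` (= `H¹(Gal(k/k₀), Ẽ_ns(k)) = 0` — Lang's theorem;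
    at a multiplicative place `Ẽ_ns` is `𝔾_m` or its quadratic twist and this is Hilbert 90 —
    pulled back along the Hensel-surjective equivariant reduction map with kernel `E₁(L)`, tree
    `WeierstrassCurve.reductionHom_surjective`; NOT proved here).
  Both halves enter as HYPOTHESES on an arbitrary subset `E₁ ⊆ E₀(L)` (intended: the kernel of
  reduction `E₁(L)`); they are the two NAMED STUBS of the OWNERS row. Printed source of (α):
  Milne *ADT* I.3.8 (`H¹(K^un/K, 𝒜°) = 0`; Gross 1991 p. 244 "[M; Ch. I, Prop. 3.8]").
* §5 **End form at `v`**: `exists_baseChange_eq_add_pow_smul` — p1's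
  `exists_mem_goodReductionSubgroup_add_pow_smul` followed by (d) and Galois descent (part 1):
  `T = ι(t₀ + p^m t₁)` with `t₀ ∈ E₀(F)`, i.e. `T ∈ E₀(K_v) + p^m E(K_v)`, so
  `δ_v(T) ∈ δ_v(E₀(K_v)) = H¹_{Kum⁰}(K_v, E[p^m])` — the conclusion of Jetchev 2008 Prop. 4.1 at
  the bad place `v`, modulo p1's inputs (a), (b), the cocycle, `hstab` and (α);
  `exists_baseChange_eq_add_pow_smul_of_halves` — the same with `hstab` discharged for the ring
  of integers and (α) replaced by the cyclic datum and the two halves.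

References (locators only; no new fact): [cite: SilvermanAEC2009, VII.2 Prop. 2.1]
[cite: MilneADT2006, Ch. I Prop. 3.8] [cite: Jetchev2008, Prop. 4.1 (p. 819)] [cite: GrossLMS1991,
Prop. 6.2 (1), pp. 244–245] [cite: SerreLocalFields1979, VIII §4, XIII §1] [cite: NeukirchANT1999,
Ch. II §9]. Design: no definitions; `noncomputable section`; `open scoped Classical`; universe `u`
for `F`, `L` as in `JetchevKummerAtP`. Axioms: `propext`, `Classical.choice`, `Quot.sound`.
-/

noncomputable section

open scoped Classical

namespace Summit.BirchSwinnertonDyer.Rank1Residual.X11b.Three.JetchevKummer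

open WeierstrassCurve

universe u

/-! ### §3 `hstab`: `E₀(L)` is stable under `Gal(L/F)` -/

section Stability

variable {F : Type u} [Field F] (W : WeierstrassCurve F) (L : Type u) [Field L] [Algebra F L]
  (R : Type*) [CommRing R] [IsDomain R] [IsDiscreteValuationRing R] [Algebra R L]
  [IsFractionRing R L]

omit [IsDomain R] [IsDiscreteValuationRing R] [IsFractionRing R L] in
/-- **`σ(R) ⊆ R` when `R` is the integral closure of `R₀` in `L`** (the ring of integers of
`L ⊇ F ⊇ R₀`): an `F`-automorphism maps `R₀`-integral elements to `R₀`-integral elements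
(Mathlib `IsIntegral.map`, `IsIntegralClosure.isIntegral_iff`). Neukirch, *ANT* II §9.
[folklore] -/
theorem algEquiv_apply_mem_range_of_isIntegralClosure (R₀ : Type*) [CommRing R₀] [Algebra R₀ F]
    [Algebra R₀ L] [IsScalarTower R₀ F L] [Algebra R₀ R] [IsScalarTower R₀ R L]
    [IsIntegralClosure R R₀ L] (σ : L ≃ₐ[F] L) {x : L} (hx : x ∈ Set.range (algebraMap R L)) :
    σ x ∈ Set.range (algebraMap R L) := by
  have hint : IsIntegral R₀ x := (IsIntegralClosure.isIntegral_iff (A := R)).mpr hx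
  have hint' : IsIntegral R₀ (σ.restrictScalars R₀ x) := hint.map (σ.restrictScalars R₀)
  exact (IsIntegralClosure.isIntegral_iff (A := R)).mp hint'

/-- **`hstab`: `E₀(L)` is `Gal(L/F)`-stable.** If every `σ ∈ Aut(L/F)` maps `R` into `R`
(hypothesis `hR`; automatic for the ring of integers, `algEquiv_apply_mem_range_of_isIntegralClosure`),
then `σ • Q ∈ E₀(L)` for `Q ∈ E₀(L)`: `σ` restricts to an automorphism of `R` (with inverse the
restriction of `σ⁻¹`), hence a local one, inducing `σ̄` on the residue field `k` with
`σ̄ ā = \overline{σ a}`; `σ̄` fixes the reduced equation `W̃` (its coefficients are residues of the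
coefficients of the `R`-model of `W ⊗ L`, which come from `F`), and `(x̄, ȳ)` is nonsingular on `W̃`
iff `(σ̄ x̄, σ̄ ȳ)` is (Mathlib `Affine.map_nonsingular`); a non-integral point stays non-integral.
Neukirch, *ANT* II §9 (the decomposition group acts on the residue field); Silverman, *AEC*
VII.2. This is the hypothesis `hstab` of `exists_mem_goodReductionSubgroup_add_pow_smul`.
[folklore] -/
theorem smul_mem_goodReductionSubgroup [(W.baseChange L).IsMinimal R]
    (hR : ∀ (σ : L ≃ₐ[F] L) (x : L), x ∈ Set.range (algebraMap R L) →
      σ x ∈ Set.range (algebraMap R L))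
    (σ : L ≃ₐ[F] L) {Q : (W.baseChange L).toAffine.Point}
    (hQ : Q ∈ (W.baseChange L).goodReductionSubgroup R) :
    σ • Q ∈ (W.baseChange L).goodReductionSubgroup R := by
  have hinj := IsFractionRing.injective R L
  -- `σ` restricted to `R`
  have hex : ∀ r : R, ∃ r' : R, algebraMap R L r' = σ (algebraMap R L r) := fun r ↦ by
    obtain ⟨r', hr'⟩ := hR σ (algebraMap R L r) ⟨r, rfl⟩
    exact ⟨r', hr'⟩
  choose f hf using hex
  let σR : R →+* R :=
    { toFun := f
      map_one' := hinj (by simp only [hf, map_one])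
      map_mul' := fun a b ↦ hinj (by simp only [hf, map_mul])
      map_zero' := hinj (by simp only [hf, map_zero])
      map_add' := fun a b ↦ hinj (by simp only [hf, map_add]) }
  have hσR : ∀ r : R, algebraMap R L (σR r) = σ (algebraMap R L r) := hf
  haveI : IsLocalHom σR := by
    refine ⟨fun a ha ↦ ?_⟩
    obtain ⟨b, hb⟩ := isUnit_iff_exists_inv.mp ha
    obtain ⟨b', hb'⟩ := hR σ⁻¹ (algebraMap R L b) ⟨b, rfl⟩
    refine isUnit_iff_exists_inv.mpr ⟨b', hinj ?_⟩
    rw [map_mul, map_one, hb']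
    have h1 : σ (algebraMap R L a) * algebraMap R L b = 1 := by
      rw [← hσR, ← map_mul, hb, map_one]
    have h2 := congrArg (σ⁻¹ : L ≃ₐ[F] L) h1
    rw [map_mul, map_one] at h2
    rwa [show (σ⁻¹ : L ≃ₐ[F] L) (σ (algebraMap R L a)) = algebraMap R L a from
      σ.symm_apply_apply _] at h2
  -- the residue automorphism
  set σk : IsLocalRing.ResidueField R →+* IsLocalRing.ResidueField R :=
    IsLocalRing.ResidueField.map σR with hσkdef
  have hσk : ∀ a : R, σk (IsLocalRing.residue R a) = IsLocalRing.residue R (σR a) := fun a ↦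
    IsLocalRing.ResidueField.map_residue σR a
  -- the `R`-model and its reduction are fixed
  set W₀ : WeierstrassCurve R := (W.baseChange L).integralModel R with hW₀
  have hfix : ∀ {r : R} (a : F), algebraMap R L r = algebraMap F L a → σR r = r := by
    intro r a hr
    exact hinj (by rw [hσR, hr, AlgEquiv.commutes])
  have h₁ : σR W₀.a₁ = W₀.a₁ := hfix W.a₁ (by rw [hW₀, integralModel_a₁_eq]; rfl)
  have h₂ : σR W₀.a₂ = W₀.a₂ := hfix W.a₂ (by rw [hW₀, integralModel_a₂_eq]; rfl)
  have h₃ : σR W₀.a₃ = W₀.a₃ := hfix W.a₃ (by rw [hW₀, integralModel_a₃_eq]; rfl)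
  have h₄ : σR W₀.a₄ = W₀.a₄ := hfix W.a₄ (by rw [hW₀, integralModel_a₄_eq]; rfl)
  have h₆ : σR W₀.a₆ = W₀.a₆ := hfix W.a₆ (by rw [hW₀, integralModel_a₆_eq]; rfl)
  have hred : ((W.baseChange L).reduction R).map σk = (W.baseChange L).reduction R := by
    rw [WeierstrassCurve.reduction, ← hW₀, WeierstrassCurve.map_map]
    ext
    · change σk (IsLocalRing.residue R W₀.a₁) = IsLocalRing.residue R W₀.a₁; rw [hσk, h₁]
    · change σk (IsLocalRing.residue R W₀.a₂) = IsLocalRing.residue R W₀.a₂; rw [hσk, h₂]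
    · change σk (IsLocalRing.residue R W₀.a₃) = IsLocalRing.residue R W₀.a₃; rw [hσk, h₃]
    · change σk (IsLocalRing.residue R W₀.a₄) = IsLocalRing.residue R W₀.a₄; rw [hσk, h₄]
    · change σk (IsLocalRing.residue R W₀.a₆) = IsLocalRing.residue R W₀.a₆; rw [hσk, h₆]
  -- now the point
  rw [WeierstrassCurve.mem_goodReductionSubgroup_iff_holds R (W.baseChange L)] at hQ ⊢
  rcases Q with _ | ⟨x, y, h⟩
  · rw [show (Affine.Point.zero : (W.baseChange L).toAffine.Point) = 0 from rfl, smul_zero]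
    trivial
  · rw [WeierstrassCurve.smul_def, Affine.Point.map_some]
    change σ x ∉ Set.range (algebraMap R L) ∨
      ∃ x₀ y₀ : R, algebraMap R L x₀ = σ x ∧ algebraMap R L y₀ = σ y ∧
        ((W.baseChange L).reduction R).toAffine.Nonsingular (IsLocalRing.residue R x₀)
          (IsLocalRing.residue R y₀)
    rcases hQ with hx | ⟨x₀, y₀, rfl, rfl, hns⟩
    · left
      intro hσx
      apply hx
      obtain ⟨r, hr⟩ := hR σ⁻¹ (σ x) hσx
      exact ⟨r, by rw [hr]; exact σ.symm_apply_apply x⟩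
    · right
      refine ⟨σR x₀, σR y₀, hσR x₀, hσR y₀, ?_⟩
      rw [← hσk, ← hσk, ← hred]
      exact (Affine.map_nonsingular _ σk.injective _ _).mpr hns

/-- `hstab` with `σ(R) ⊆ R` discharged for the ring of integers `R` of `L` (integral closure of a
subring `R₀ ⊆ F`). [folklore] -/
theorem smul_mem_goodReductionSubgroup_of_isIntegralClosure [(W.baseChange L).IsMinimal R]
    (R₀ : Type*) [CommRing R₀] [Algebra R₀ F] [Algebra R₀ L] [IsScalarTower R₀ F L] [Algebra R₀ R]
    [IsScalarTower R₀ R L] [IsIntegralClosure R R₀ L]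
    (σ : L ≃ₐ[F] L) {Q : (W.baseChange L).toAffine.Point}
    (hQ : Q ∈ (W.baseChange L).goodReductionSubgroup R) :
    σ • Q ∈ (W.baseChange L).goodReductionSubgroup R :=
  smul_mem_goodReductionSubgroup W L R
    (fun τ _ hx ↦ algEquiv_apply_mem_range_of_isIntegralClosure L R R₀ τ hx) σ hQ

end Stability

/-! ### §4 (α): `H¹` of a cyclic group, and the `E₁`-dévissage (pure algebra) -/

section Cyclic

variable {D A : Type*} [Group D] [AddCommGroup A] [DistribMulAction D A]

/-- Telescoping: `Σ_{j<n} φʲ (φ a − a) = φⁿ a − a`. [folklore] -/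
theorem sum_range_pow_smul_smul_sub (φ : D) (a : A) (n : ℕ) :
    ∑ j ∈ Finset.range n, φ ^ j • (φ • a - a) = φ ^ n • a - a := by
  induction n with
  | zero => simp
  | succ n ih => rw [Finset.sum_range_succ, ih, smul_sub, ← mul_smul, ← pow_succ]; abel

/-- A point fixed by `φ` is fixed by every element of `⟨φ⟩`. [folklore] -/
theorem smul_eq_self_of_mem_zpowers {φ σ : D} (hσ : σ ∈ Subgroup.zpowers φ) {a : A}
    (ha : φ • a = a) : σ • a = a := by
  have hle : Subgroup.zpowers φ ≤ MulAction.stabilizer D a := by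
    rw [Subgroup.zpowers_le, MulAction.mem_stabilizer_iff]
    exact ha
  exact MulAction.mem_stabilizer_iff.mp (hle hσ)

/-- **`H¹(⟨φ⟩, B) = 0` in cyclic form ⇒ `(A/B)^D` is the image of `A^D`** (p1's hypothesis
`hα`). If `D = ⟨φ⟩` with `φⁿ = 1`, and every `m ∈ B` with `Σ_{j<n} φʲ m = 0` is `φ P − P` for
some `P ∈ B` (the vanishing of `H¹` of the cyclic group `D` with values in `B`, written with the
standard resolution `Ĥ⁻¹ → H¹`: kernel of the norm modulo `(φ − 1)`), then every `a ∈ A` whose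
coboundary `σ ↦ σ a − a` takes values in `B` is congruent modulo `B` to a `D`-fixed element:
apply the hypothesis to `m = φ a − a` (`Σ φʲ m = φⁿ a − a = 0`) and take `a' = a − P`. Serre,
*Local Fields* VIII §4 (cohomology of cyclic groups). [folklore] -/
theorem exists_fixed_sub_mem_of_cyclic (B : AddSubgroup A) {φ : D}
    (hφ : ∀ σ : D, σ ∈ Subgroup.zpowers φ) {n : ℕ} (hn : φ ^ n = 1)
    (h1 : ∀ m ∈ B, ∑ j ∈ Finset.range n, φ ^ j • m = 0 → ∃ P ∈ B, φ • P - P = m)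
    (a : A) (ha : ∀ σ : D, σ • a - a ∈ B) :
    ∃ a' : A, (∀ σ : D, σ • a' = a') ∧ a - a' ∈ B := by
  obtain ⟨P, hPB, hP⟩ := h1 (φ • a - a) (ha φ)
    (by rw [sum_range_pow_smul_smul_sub, hn, one_smul, sub_self])
  refine ⟨a - P, fun σ ↦ smul_eq_self_of_mem_zpowers (hφ σ) ?_, by rwa [sub_sub_cancel]⟩
  rw [smul_sub]
  exact sub_eq_sub_iff_sub_eq_sub.mp hP.symm

/-- **Dévissage of the cyclic `H¹` along `E₁ ⊆ B`**: if (`h1ker`) every `m ∈ E₁` with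
`Σ_{j<n} φʲ m = 0` is `φ P − P` with `P ∈ E₁`, and (`h1red`) every `m ∈ B` with `Σ φʲ m = 0` is
congruent to some `φ C − C`, `C ∈ B`, modulo `E₁`, then every `m ∈ B` with `Σ φʲ m = 0` is
`φ P − P` with `P ∈ B` (take `P = C + P'`). This is the exactness of
`H¹(D, E₁) → H¹(D, B) → H¹(D, B/E₁)` in the middle, in cyclic form, for `φⁿ = 1`.
Serre, *Local Fields* VIII §4. [folklore] -/
theorem cyclicH1_of_subset (B : AddSubgroup A) (E₁ : Set A) (hE₁ : E₁ ⊆ B) {φ : D} {n : ℕ}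
    (hn : φ ^ n = 1)
    (h1ker : ∀ m ∈ E₁, ∑ j ∈ Finset.range n, φ ^ j • m = 0 → ∃ P ∈ E₁, φ • P - P = m)
    (h1red : ∀ m ∈ B, ∑ j ∈ Finset.range n, φ ^ j • m = 0 → ∃ C ∈ B, m - (φ • C - C) ∈ E₁) :
    ∀ m ∈ B, ∑ j ∈ Finset.range n, φ ^ j • m = 0 → ∃ P ∈ B, φ • P - P = m := by
  intro m hm hs
  obtain ⟨C, hCB, hC⟩ := h1red m hm hs
  have hsum : ∑ j ∈ Finset.range n, φ ^ j • (m - (φ • C - C)) = 0 := by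
    have : ∑ j ∈ Finset.range n, φ ^ j • (m - (φ • C - C)) =
        ∑ j ∈ Finset.range n, φ ^ j • m - ∑ j ∈ Finset.range n, φ ^ j • (φ • C - C) := by
      rw [← Finset.sum_sub_distrib]
      exact Finset.sum_congr rfl fun j _ ↦ smul_sub (φ ^ j) m _
    rw [this, hs, sum_range_pow_smul_smul_sub, hn, one_smul, sub_self, sub_zero]
  obtain ⟨P', hP'E, hP'⟩ := h1ker _ hC hsum
  refine ⟨C + P', B.add_mem hCB (hE₁ hP'E), ?_⟩
  calc φ • (C + P') - (C + P') = (φ • C - C) + (φ • P' - P') := by rw [smul_add]; abel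
    _ = m := by rw [hP']; abel

end Cyclic

/-! ### §4 (α) on points: p1's `hα` from the two halves -/

section OnPoints

variable {F : Type u} [Field F] (W : WeierstrassCurve F) (L : Type u) [Field L] [Algebra F L]
  (R : Type*) [CommRing R] [IsDomain R] [IsDiscreteValuationRing R] [Algebra R L]
  [IsFractionRing R L] [(W.baseChange L).IsMinimal R]

/-- **(α) reduced to its two halves.** Let `Gal(L/F)` be cyclic, generated by `φ` with `φⁿ = 1`
(for the unramified `L_w/K_v` of `JetchevKummerAtP`: `φ` the Frobenius, `n = [L_w : K_v]`), and let
`E₁ ⊆ E₀(L)` be a subset (intended: the kernel of reduction `E₁(L)`, Silverman *AEC* VII.2) such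
that
* `h1ker` (**formal-group half**, `H¹(Gal, E₁(L)) = 0`): every `m ∈ E₁` with `Σ_{j<n} φʲ m = O` is
  `φ P − P` for some `P ∈ E₁` — for `E₁(L)` over a complete unramified layer this is the successive
  approximation of the tree's `FormalGroupChart.exists_map_sub_eq_of_sum_eq_zero`
  (`UnramifiedFormalGroupH1Proofs`; Milne *ADT* I.3.8, proof; Serre *Local Fields* V §2, XIII §1);
* `h1red` (**`Ẽ_ns` half, lifted**): every `m ∈ E₀(L)` with `Σ_{j<n} φʲ m = O` is congruent modulo
  `E₁` to `φ C − C` for some `C ∈ E₀(L)` — for `E₁(L)` this is `H¹(Gal(k/k₀), Ẽ_ns(k)) = 0` (Lang's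
  theorem; at a multiplicative place `Ẽ_ns` is `𝔾_m` or its quadratic twist and this is Hilbert's
  Theorem 90) pulled back along the surjective equivariant reduction `E₀(L) → Ẽ_ns(k)` with kernel
  `E₁(L)` (*AEC* VII.2.1; tree `WeierstrassCurve.reductionHom_surjective`);
then p1's hypothesis `hα` holds: every `Q ∈ E(L)` with all `σ Q − Q ∈ E₀(L)` is congruent modulo
`E₀(L)` to a `Gal(L/F)`-fixed point. The two halves are carried as hypotheses (the OWNERS row's
named stubs); nothing else is assumed. Gross 1991, p. 244 "[M; Ch. I, Prop. 3.8]" = Milne, *ADT*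
I.3.8 (`H¹(K^un/K, 𝒜°) = 0`). [folklore] -/
theorem hα_of_cyclic_of_halves (φ : L ≃ₐ[F] L) (hφ : ∀ σ : L ≃ₐ[F] L, σ ∈ Subgroup.zpowers φ)
    {n : ℕ} (hn : φ ^ n = 1) (E₁ : Set (W.baseChange L).toAffine.Point)
    (hE₁ : E₁ ⊆ (W.baseChange L).goodReductionSubgroup R)
    (h1ker : ∀ m ∈ E₁, ∑ j ∈ Finset.range n, (φ ^ j) • m = 0 → ∃ P ∈ E₁, φ • P - P = m)
    (h1red : ∀ m ∈ (W.baseChange L).goodReductionSubgroup R,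
      ∑ j ∈ Finset.range n, (φ ^ j) • m = 0 →
        ∃ C ∈ (W.baseChange L).goodReductionSubgroup R, m - (φ • C - C) ∈ E₁) :
    ∀ Q : (W.baseChange L).toAffine.Point,
      (∀ σ : L ≃ₐ[F] L, σ • Q - Q ∈ (W.baseChange L).goodReductionSubgroup R) →
        ∃ Q' : (W.baseChange L).toAffine.Point, (∀ σ : L ≃ₐ[F] L, σ • Q' = Q') ∧
          Q - Q' ∈ (W.baseChange L).goodReductionSubgroup R :=
  fun Q hQ ↦ exists_fixed_sub_mem_of_cyclic ((W.baseChange L).goodReductionSubgroup R) hφ hn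
    (cyclicH1_of_subset ((W.baseChange L).goodReductionSubgroup R) E₁ hE₁ hn h1ker h1red) Q hQ

/-- **(α) ⇐ `H¹(Gal(L/F), E₀(L)) = 0` in cyclic form** (no dévissage): the one-hypothesis
version of `hα_of_cyclic_of_halves`. [folklore] -/
theorem hα_of_cyclicH1 (φ : L ≃ₐ[F] L) (hφ : ∀ σ : L ≃ₐ[F] L, σ ∈ Subgroup.zpowers φ)
    {n : ℕ} (hn : φ ^ n = 1)
    (h1 : ∀ m ∈ (W.baseChange L).goodReductionSubgroup R,
      ∑ j ∈ Finset.range n, (φ ^ j) • m = 0 →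
        ∃ P ∈ (W.baseChange L).goodReductionSubgroup R, φ • P - P = m) :
    ∀ Q : (W.baseChange L).toAffine.Point,
      (∀ σ : L ≃ₐ[F] L, σ • Q - Q ∈ (W.baseChange L).goodReductionSubgroup R) →
        ∃ Q' : (W.baseChange L).toAffine.Point, (∀ σ : L ≃ₐ[F] L, σ • Q' = Q') ∧
          Q - Q' ∈ (W.baseChange L).goodReductionSubgroup R :=
  fun Q hQ ↦ exists_fixed_sub_mem_of_cyclic ((W.baseChange L).goodReductionSubgroup R) hφ hn h1 Q hQ

end OnPoints

/-! ### §5 End form at the bad place `v`: `T ∈ E₀(K_v) + p^m E(K_v)` -/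

section EndForm

variable {F : Type u} [Field F] (W : WeierstrassCurve F) (L : Type u) [Field L] [Algebra F L]
  (R₀ : Type*) [CommRing R₀] [IsDomain R₀] [IsDiscreteValuationRing R₀] [Algebra R₀ F]
  [IsFractionRing R₀ F]
  (R : Type*) [CommRing R] [IsDomain R] [IsDiscreteValuationRing R] [Algebra R L]
  [IsFractionRing R L]
  [Algebra R₀ R] [Algebra R₀ L] [IsScalarTower R₀ R L] [IsScalarTower R₀ F L]

/-- **Jetchev's Prop. 4.1 at a bad place `v`, conclusion in `E(K_v)`** (modulo p1's inputs). In the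
dictionary of `JetchevKummerAtP` with `L/F` Galois and `R ∩ F = R₀`: from `hstab`, (α) `hα`, input
(a) `hT`, input (b) `hP`/`hR`, and the cocycle `hU`/`hpU`, the point `T` is `ι(t₀ + p^m t₁)` with
`t₀ ∈ E₀(F) = E₀(K_v)` and `t₁ ∈ E(K_v)` — i.e. `T ∈ E₀(K_v) + p^m E(K_v)`, so that
`δ_v(T) ∈ δ_v(E₀(K_v)) = H¹_{Kum⁰}(K_v, E[p^m])` (Jetchev's connected Kummer condition at `v`).
Proof: p1's `exists_mem_goodReductionSubgroup_add_pow_smul` gives `T = T₀ + p^m T₁` with `T₀, T₁`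
fixed and `T₀ ∈ E₀(L)`; Galois descent (§2) and (d) (§1) give `T₀ = ι t₀`, `t₀ ∈ E₀(F)`, and
`T₁ = ι t₁`. Inputs (a), (b), (α) and the link (c) remain p1's named inputs; flag `JET@p|N` NOT
discharged. [cite: Jetchev2008, Prop. 4.1 (p. 819)] [cite: GrossLMS1991, Prop. 6.2 (1), pp. 244–245] -/
theorem exists_baseChange_eq_add_pow_smul [IsGalois F L] [IsLocalHom (algebraMap R₀ R)]
    [(W.baseChange F).IsMinimal R₀] [(W.baseChange L).IsMinimal R]
    (hstab : ∀ (σ : L ≃ₐ[F] L) (Q : (W.baseChange L).toAffine.Point),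
      Q ∈ (W.baseChange L).goodReductionSubgroup R → σ • Q ∈ (W.baseChange L).goodReductionSubgroup R)
    (hα : ∀ Q : (W.baseChange L).toAffine.Point,
      (∀ σ : L ≃ₐ[F] L, σ • Q - Q ∈ (W.baseChange L).goodReductionSubgroup R) →
        ∃ Q' : (W.baseChange L).toAffine.Point, (∀ σ : L ≃ₐ[F] L, σ • Q' = Q') ∧
          Q - Q' ∈ (W.baseChange L).goodReductionSubgroup R)
    {p m n' : ℕ} (hcop : Nat.Coprime n' (p ^ m)) {U P T : (W.baseChange L).toAffine.Point}
    {Rσ : (L ≃ₐ[F] L) → (W.baseChange L).toAffine.Point}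
    (hT : ∀ σ : L ≃ₐ[F] L, σ • T = T)
    (hP : (n' : ℤ) • P ∈ (W.baseChange L).goodReductionSubgroup R)
    (hR : ∀ σ : L ≃ₐ[F] L, (n' : ℤ) • Rσ σ ∈ (W.baseChange L).goodReductionSubgroup R)
    (hU : ∀ σ : L ≃ₐ[F] L, σ • U - U = Rσ σ) (hpU : ((p ^ m : ℕ) : ℤ) • U = P - T) :
    ∃ t₀ t₁ : (W.baseChange F).toAffine.Point,
      t₀ ∈ (W.baseChange F).goodReductionSubgroup R₀ ∧
      T = Affine.Point.baseChange (W' := W.toAffine) F L (t₀ + ((p ^ m : ℕ) : ℤ) • t₁) := by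
  obtain ⟨T₀, T₁, hT₀, hT₁, hT₀E, hTT⟩ :=
    exists_mem_goodReductionSubgroup_add_pow_smul W L R hstab hα hcop hT hP hR hU hpU
  obtain ⟨t₀, ht₀, rfl⟩ :=
    (mem_goodReductionSubgroup_iff_exists_of_forall_smul_eq W L R₀ R hT₀).mp hT₀E
  obtain ⟨t₁, rfl⟩ := exists_baseChange_eq_of_forall_smul_eq W L T₁ hT₁
  exact ⟨t₀, t₁, ht₀, by rw [hTT, map_add, map_zsmul]⟩

/-- **End form at `v` from the named stubs only.** `exists_baseChange_eq_add_pow_smul` with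
`hstab` DISCHARGED (`R` the ring of integers of `L`, i.e. the integral closure of `R₀`) and (α)
REPLACED by the cyclic datum (`Gal(L/F) = ⟨φ⟩`, `φⁿ = 1`) and its two halves `h1ker` / `h1red` on
a subset `E₁ ⊆ E₀(L)` (intended: the kernel of reduction): what remains besides p1's inputs (a),
(b) and the cocycle are exactly the two `H¹`-halves. `T = ι(t₀ + p^m t₁)`, `t₀ ∈ E₀(K_v)`.
[cite: Jetchev2008, Prop. 4.1 (p. 819)] [cite: MilneADT2006, Ch. I Prop. 3.8 (PDF pp. 46–47)] -/
theorem exists_baseChange_eq_add_pow_smul_of_halves [IsGalois F L] [IsLocalHom (algebraMap R₀ R)]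
    [IsIntegralClosure R R₀ L] [(W.baseChange F).IsMinimal R₀] [(W.baseChange L).IsMinimal R]
    (φ : L ≃ₐ[F] L) (hφ : ∀ σ : L ≃ₐ[F] L, σ ∈ Subgroup.zpowers φ) {n : ℕ} (hn : φ ^ n = 1)
    (E₁ : Set (W.baseChange L).toAffine.Point)
    (hE₁ : E₁ ⊆ (W.baseChange L).goodReductionSubgroup R)
    (h1ker : ∀ m ∈ E₁, ∑ j ∈ Finset.range n, (φ ^ j) • m = 0 → ∃ P ∈ E₁, φ • P - P = m)
    (h1red : ∀ m ∈ (W.baseChange L).goodReductionSubgroup R,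
      ∑ j ∈ Finset.range n, (φ ^ j) • m = 0 →
        ∃ C ∈ (W.baseChange L).goodReductionSubgroup R, m - (φ • C - C) ∈ E₁)
    {p m n' : ℕ} (hcop : Nat.Coprime n' (p ^ m)) {U P T : (W.baseChange L).toAffine.Point}
    {Rσ : (L ≃ₐ[F] L) → (W.baseChange L).toAffine.Point}
    (hT : ∀ σ : L ≃ₐ[F] L, σ • T = T)
    (hP : (n' : ℤ) • P ∈ (W.baseChange L).goodReductionSubgroup R)
    (hR : ∀ σ : L ≃ₐ[F] L, (n' : ℤ) • Rσ σ ∈ (W.baseChange L).goodReductionSubgroup R)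
    (hU : ∀ σ : L ≃ₐ[F] L, σ • U - U = Rσ σ) (hpU : ((p ^ m : ℕ) : ℤ) • U = P - T) :
    ∃ t₀ t₁ : (W.baseChange F).toAffine.Point,
      t₀ ∈ (W.baseChange F).goodReductionSubgroup R₀ ∧
      T = Affine.Point.baseChange (W' := W.toAffine) F L (t₀ + ((p ^ m : ℕ) : ℤ) • t₁) :=
  exists_baseChange_eq_add_pow_smul W L R₀ R
    (fun σ _ hQ ↦ smul_mem_goodReductionSubgroup_of_isIntegralClosure W L R R₀ σ hQ)
    (hα_of_cyclic_of_halves W L R φ hφ hn E₁ hE₁ h1ker h1red) hcop hT hP hR hU hpU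

end EndForm

end Summit.BirchSwinnertonDyer.Rank1Residual.X11b.Three.JetchevKummer

end
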